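import Summits.AtomisticToContinuum.BoseEinsteinCondensation.Theses.BECEqualScatteringTransfer
import Summits.AtomisticToContinuum.BoseEinsteinCondensation.Theses.BECChargeConjugationRP
import Summits.AtomisticToContinuum.BoseEinsteinCondensation.Theorems.HardCoreExtension.Negative.ScalingReductions
import Summits.AtomisticToContinuum.BoseEinsteinCondensation.Theorems.BECDyadicChainingDyadicCoherenceDefectZeroScatteringEnergy
import Literature.MathematicalPhysics.QuantumManyBody.ScatteringLengthTruncationHardCore
import Literature.MathematicalPhysics.QuantumManyBody.BoseGasHardCoreIntegrableTail

/-!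
# Line `gauge` for the crux `ScatteringLengthTransfer` (stmt-AtomisticToContinuum-9048)

Strategist (cstrat s2) ALTERNATIVE line; it does not touch `Lines/birth.lean` / `Lines/slack.lean`.

Crux (fixed, by name; shared verbatim by the routes BECEqualScatteringTransfer /
BECChargeConjugationRP / BECFeynmanVortexArea / BECPhaseQuadratureSumRule): for admissible `v`
(bounded) and `w` (arbitrary: hard cores allowed) with `scatteringLength v = scatteringLength w`,
small-density Dirichlet ground-state BEC for `v` implies small-density ground-state BEC for `w`.

## The lever: equal scattering length is a GAUGE, not information

The Dirichlet Bose gas has the exact dilation symmetry `v ↦ s⁻²v(·/s)`, `L ↦ sL`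
(`JelliumBoseGas.condensateNumber_dilate`), under which small-density BEC is INVARIANT
(`diluteBEC_scalePotential_iff`), admissibility and boundedness are preserved, and the scattering
length scales, `𝔞(s⁻²v(·/s)) = s·𝔞(v)` (`scatteringLength_scalePotential`). Hence the hypothesis
`𝔞(v) = 𝔞(w)` of the crux can always be ARRANGED (rescale `v`; its dilute BEC comes along) and the
crux is equivalent to the zero-one law "if one bounded admissible gas with `𝔞 > 0` condenses at all
small densities then every admissible gas does" (the corner `𝔞 = 0` is the free gas a.e.,
`diluteBEC_of_scatteringLength_eq_zero`, proved here). Fixing the gauge `𝔞 = 1` splits the crux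
into two pieces of different nature, neither of which is the crux reworded:

* `stub_boundedTransfer` (BT, the SOFT heart; pointwise, no class-uniformity, no hard cores):
  for bounded admissible `v, u` with `𝔞(v) = 𝔞(u) = 1`, dilute BEC of `v` implies dilute BEC of `u`.
  This is the natural target of the corrector / completed-Dyson-lemma method (both sides soft, one
  length unit), and it is strictly weaker than the uniform transfers GUT (`birth`) / UST (`slack`),
  which ask for ONE constant `c` over the non-compact bounded equal-`𝔞` class of range `≤ R`.
* `stub_softClosure` (SC, the HARD-CORE piece, unit gauge): if EVERY bounded admissible gas with
  `𝔞 = 1` condenses at small density then so does every admissible gas with `𝔞 = 1` (hard cores,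
  shells, `⊤` on null sets). This is implied by the standing crux `HardCoreExtension`
  (stmt-AtomisticToContinuum-11786, route BECConjugateDomination) — PROVED below,
  `softClosure_of_hardCoreExtension` — so closing stmt-11786 closes SC by one `exact`; SC is weaker
  than HCE (bounded ⊋ smooth class after cutting negative radii; conclusion only at `𝔞 = 1`).

`ScatteringLengthTransfer_of : BT → SC → ScatteringLengthTransfer` is sorry-free (gauge fixing by
`s = 1/𝔞`, the `𝔞 = 0` corner, bounded rescaling); `ScatteringLengthTransfer_proof` is the
registration form at the BECChargeConjugationRP copy (definitionally the same statement).
Sorries: exactly the two `stub_*`.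
-/

noncomputable section

namespace Summit.AtomisticToContinuum.BoseEinsteinCondensation.Cruxes.ScatteringLengthTransfer.Gauge

open Filter MeasureTheory
open scoped ENNReal NNReal
open Literature.MathematicalPhysics.QuantumManyBody.BoseGas
open Summit.AtomisticToContinuum.BoseEinsteinCondensation.Theorems.HardCoreExtension.Negative

/-! ## The two registered stubs -/

/-- **Stub BT — bounded (soft) transfer in the unit gauge.** For bounded admissible `v, u` with
`scatteringLength v = scatteringLength u = 1`, small-density ground-state BEC of `v` implies
small-density ground-state BEC of `u`. Pointwise in `(v, u)`: no uniformity of `ρ₀, c` over a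
class is asked, and no hard core is ever met. Why plausibly true: both are the BEC conjecture for
soft potentials; the intended mechanism is a soft-to-soft corrector comparison at fixed `𝔞`
(completed Dyson lemma: both `H_v` and `H_u` dominate the same nearest-neighbour `U_R`-Hamiltonian
up to `ε T`, LSSY2005 Lemma 2.5 / Thm 6.1; second-order renormalised potentials, arXiv:2203.01841).
Why it might fail as a LEMMA: no monotonicity / continuity of `λ_max(γ)` in `v` is known
(`not_condensateNumber_mono_potential`), so BEC of `v` may carry no usable information about `u`
beyond what a direct proof for `u` needs. Size: XL (it is the soft case of the conjunct, made
relative). [cite: LSSY2005, Ch. 2 Lemma 2.5, Ch. 5 p. 42; arXiv:2203.01841] -/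
theorem stub_boundedTransfer :
    ∀ v u : ℝ → ℝ≥0∞, IsRepulsiveFiniteRange v → IsRepulsiveFiniteRange u →
      (∃ M : ℝ≥0, ∀ r, v r ≤ M) → (∃ M : ℝ≥0, ∀ r, u r ≤ M) →
      scatteringLength v = 1 → scatteringLength u = 1 →
      (∃ ρ₀ : ℝ, 0 < ρ₀ ∧ ∀ ρ : ℝ, 0 < ρ → ρ < ρ₀ → HasGroundStateBEC v ρ) →
      ∃ ρ₀ : ℝ, 0 < ρ₀ ∧ ∀ ρ : ℝ, 0 < ρ → ρ < ρ₀ → HasGroundStateBEC u ρ := by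
  sorry

/-- **Stub SC — soft closure in the unit gauge.** If every BOUNDED admissible potential of
scattering length `1` has small-density ground-state BEC, then so does every admissible potential
of scattering length `1` (hard cores `v = ⊤` on balls / shells / null sets included). Implied by
the standing crux `BECConjugateDomination.HardCoreExtension` (stmt-11786):
`softClosure_of_hardCoreExtension` below. Intended direct mechanism: the truncation tower
`min(w, n) ↑ w` (bounded, admissible, `𝔞(min(w,n)) ↑ 𝔞(w)`, FGJMOT Lemma 3.3 in the tree) rescaled
to `𝔞 = 1`, plus a density threshold / condensate fraction UNIFORM along the tower and the tree's
fixed-volume tower limit (`periodicBEC_of_exists_smoothTowerBEC_hardCore` pattern). Why it might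
fail as a LEMMA: pointwise BEC along the tower gives `ρ₀(uₙ), c(uₙ)` with no control as `n → ∞`
(`criticalDensity_eq_top_of_noHardCore`: soft gases condense at NO large density while hard spheres
jam). Size: XL (shared with stmt-11786). [cite: LSSY2005, Ch. 5 p. 42; Dyson1957; LiebYngvason1998] -/
theorem stub_softClosure :
    (∀ u : ℝ → ℝ≥0∞, IsRepulsiveFiniteRange u → (∃ M : ℝ≥0, ∀ r, u r ≤ M) →
        scatteringLength u = 1 →
        ∃ ρ₀ : ℝ, 0 < ρ₀ ∧ ∀ ρ : ℝ, 0 < ρ → ρ < ρ₀ → HasGroundStateBEC u ρ) →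
    ∀ w : ℝ → ℝ≥0∞, IsRepulsiveFiniteRange w → scatteringLength w = 1 →
      ∃ ρ₀ : ℝ, 0 < ρ₀ ∧ ∀ ρ : ℝ, 0 < ρ → ρ < ρ₀ → HasGroundStateBEC w ρ := by
  sorry

/-! ## The `𝔞 = 0` corner (proved): zero scattering length is the free gas -/

/-- Potentials with the same energy form have the same condensate number. [folklore] -/
theorem condensateNumber_congr_energy {v v' : ℝ → ℝ≥0∞} {N : ℕ} {L : ℝ}
    (h : ∀ Ψ : TrialState N L, energy v Ψ = energy v' Ψ) :
    condensateNumber v N L = condensateNumber v' N L := by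
  have hE : groundStateEnergy v N L = groundStateEnergy v' N L := by
    unfold groundStateEnergy
    exact iInf_congr h
  unfold condensateNumber
  simp_rw [h, hE]

/-- Potentials with the same energy forms have the same ground-state BEC. [folklore] -/
theorem hasGroundStateBEC_congr_energy {v v' : ℝ → ℝ≥0∞}
    (h : ∀ (N : ℕ) (L : ℝ) (Ψ : TrialState N L), energy v Ψ = energy v' Ψ) (ρ : ℝ) :
    HasGroundStateBEC v ρ ↔ HasGroundStateBEC v' ρ := by
  have hc : ∀ (N : ℕ) (L : ℝ), condensateNumber v N L = condensateNumber v' N L :=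
    fun N L => condensateNumber_congr_energy (h N L)
  unfold HasGroundStateBEC
  simp_rw [hc]

/-- Potentials agreeing on `[0, ∞)` (the only radii ever evaluated) have the same ground-state BEC.
[folklore] -/
theorem hasGroundStateBEC_congr_nonneg {v v' : ℝ → ℝ≥0∞} (h : ∀ r, 0 ≤ r → v r = v' r) (ρ : ℝ) :
    HasGroundStateBEC v ρ ↔ HasGroundStateBEC v' ρ := by
  refine hasGroundStateBEC_congr_energy (fun N L Ψ => ?_) ρ
  unfold energy
  simp only [interaction_congr_nonneg h]

/-- **The `𝔞 = 0` corner.** An admissible potential with zero scattering length vanishes a.e. on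
`(0, ∞)` (LSSY App. C), its energy form is the free one
(`DyadicCoherenceDefect.Birth.stub_zeroScatteringEnergy`, a landed theorem despite its name), and
the free Dirichlet gas condenses at every density (`hasGroundStateBEC_zero`).
[cite: LSSY2005, App. C Thm C.1 and §1.2 (1.19)] -/
theorem diluteBEC_of_scatteringLength_eq_zero {w : ℝ → ℝ≥0∞} (hw : IsRepulsiveFiniteRange w)
    (h0 : scatteringLength w = 0) :
    ∃ ρ₀ : ℝ, 0 < ρ₀ ∧ ∀ ρ : ℝ, 0 < ρ → ρ < ρ₀ → HasGroundStateBEC w ρ := by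
  refine ⟨1, one_pos, fun ρ hρ _ => ?_⟩
  have hE : ∀ (N : ℕ) (L : ℝ) (Ψ : TrialState N L), energy w Ψ = energy 0 Ψ :=
    Summit.AtomisticToContinuum.BoseEinsteinCondensation.Cruxes.DyadicCoherenceDefect.Birth.stub_zeroScatteringEnergy
      w hw h0
  rw [hasGroundStateBEC_congr_energy hE ρ]
  exact hasGroundStateBEC_zero hρ

/-! ## Gauge fixing `𝔞 = 1` by dilation (proved) -/

/-- Rescaling keeps a bounded potential bounded (`s⁻²M`). [folklore] -/
theorem scalePotential_bounded {v : ℝ → ℝ≥0∞} (hM : ∃ M : ℝ≥0, ∀ r, v r ≤ M) (s : ℝ) :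
    ∃ M : ℝ≥0, ∀ r, scalePotential s v r ≤ M := by
  obtain ⟨M, hM⟩ := hM
  refine ⟨((s ^ 2)⁻¹).toNNReal * M, fun r => ?_⟩
  rw [scalePotential_apply, ENNReal.coe_mul]
  exact mul_le_mul' (le_of_eq rfl) (hM _)

/-- **Unit gauge**: for `0 < 𝔞(v) < ∞`, the dilate `v₁ = s⁻²v(·/s)` with `s = 1/𝔞(v)` has
`𝔞(v₁) = 1`. [folklore] -/
theorem scatteringLength_scalePotential_eq_one {v : ℝ → ℝ≥0∞} (h0 : scatteringLength v ≠ 0)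
    (htop : scatteringLength v ≠ ⊤) :
    scatteringLength (scalePotential (scatteringLength v).toReal⁻¹ v) = 1 := by
  have hpos : 0 < (scatteringLength v).toReal := ENNReal.toReal_pos h0 htop
  rw [scatteringLength_scalePotential v (inv_pos.2 hpos), ENNReal.ofReal_inv_of_pos hpos,
    ENNReal.ofReal_toReal htop, ENNReal.inv_mul_cancel h0 htop]

/-- **Un-gauging**: BEC for the bounded unit-`𝔞` class gives BEC for every bounded admissible
potential (rescale to `𝔞 = 1`, or use the `𝔞 = 0` corner). [folklore] -/
theorem diluteBEC_bounded_of_unitGauge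
    (hsoft : ∀ u : ℝ → ℝ≥0∞, IsRepulsiveFiniteRange u → (∃ M : ℝ≥0, ∀ r, u r ≤ M) →
        scatteringLength u = 1 →
        ∃ ρ₀ : ℝ, 0 < ρ₀ ∧ ∀ ρ : ℝ, 0 < ρ → ρ < ρ₀ → HasGroundStateBEC u ρ)
    (u : ℝ → ℝ≥0∞) (hu : IsRepulsiveFiniteRange u) (huM : ∃ M : ℝ≥0, ∀ r, u r ≤ M) :
    ∃ ρ₀ : ℝ, 0 < ρ₀ ∧ ∀ ρ : ℝ, 0 < ρ → ρ < ρ₀ → HasGroundStateBEC u ρ := by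
  by_cases h0 : scatteringLength u = 0
  · exact diluteBEC_of_scatteringLength_eq_zero hu h0
  have htop : scatteringLength u ≠ ⊤ := hu.scatteringLength_ne_top
  have hs : 0 < (scatteringLength u).toReal⁻¹ := inv_pos.2 (ENNReal.toReal_pos h0 htop)
  exact (diluteBEC_scalePotential_iff u hs).1
    (hsoft _ (isRepulsiveFiniteRange_scalePotential hu hs) (scalePotential_bounded huM _)
      (scatteringLength_scalePotential_eq_one h0 htop))

/-! ## Composition (sorry-free): the two stubs give the crux BY NAME -/

/-- **`BT → SC → ScatteringLengthTransfer`.** Given the crux data `(v, w)`: if `𝔞(w) = 0` the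
corner lemma concludes. Otherwise `𝔞 := 𝔞(v) = 𝔞(w) ∈ (0, ∞)`; rescale `v` to `v₁` with
`𝔞(v₁) = 1` (bounded, admissible, dilute BEC transported by dilation invariance); BT from `v₁` gives
dilute BEC of EVERY bounded admissible unit-`𝔞` potential; SC then gives it for the rescaled target
`w₁ = s⁻²w(·/s)` (`𝔞(w₁) = 1`), and dilation invariance returns to `w`. -/
theorem ScatteringLengthTransfer_of :
    (∀ v u : ℝ → ℝ≥0∞, IsRepulsiveFiniteRange v → IsRepulsiveFiniteRange u →
      (∃ M : ℝ≥0, ∀ r, v r ≤ M) → (∃ M : ℝ≥0, ∀ r, u r ≤ M) →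
      scatteringLength v = 1 → scatteringLength u = 1 →
      (∃ ρ₀ : ℝ, 0 < ρ₀ ∧ ∀ ρ : ℝ, 0 < ρ → ρ < ρ₀ → HasGroundStateBEC v ρ) →
      ∃ ρ₀ : ℝ, 0 < ρ₀ ∧ ∀ ρ : ℝ, 0 < ρ → ρ < ρ₀ → HasGroundStateBEC u ρ) →
    ((∀ u : ℝ → ℝ≥0∞, IsRepulsiveFiniteRange u → (∃ M : ℝ≥0, ∀ r, u r ≤ M) →
        scatteringLength u = 1 →
        ∃ ρ₀ : ℝ, 0 < ρ₀ ∧ ∀ ρ : ℝ, 0 < ρ → ρ < ρ₀ → HasGroundStateBEC u ρ) →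
      ∀ w : ℝ → ℝ≥0∞, IsRepulsiveFiniteRange w → scatteringLength w = 1 →
        ∃ ρ₀ : ℝ, 0 < ρ₀ ∧ ∀ ρ : ℝ, 0 < ρ → ρ < ρ₀ → HasGroundStateBEC w ρ) →
    Summit.AtomisticToContinuum.BoseEinsteinCondensation.Theses.BECEqualScatteringTransfer.ScatteringLengthTransfer := by
  intro hBT hSC v w hv hw hvM hvw hBECv
  by_cases h0 : scatteringLength w = 0
  · exact diluteBEC_of_scatteringLength_eq_zero hw h0
  -- the common scattering length is finite and positive: fix the gauge `𝔞 = 1`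
  have hv0 : scatteringLength v ≠ 0 := fun h => h0 (hvw ▸ h)
  have hvtop : scatteringLength v ≠ ⊤ := hv.scatteringLength_ne_top
  have hwtop : scatteringLength w ≠ ⊤ := hw.scatteringLength_ne_top
  have hs : 0 < (scatteringLength w).toReal⁻¹ := inv_pos.2 (ENNReal.toReal_pos h0 hwtop)
  -- the rescaled hypothesis potential `v₁`
  have hv₁ : IsRepulsiveFiniteRange (scalePotential (scatteringLength w).toReal⁻¹ v) :=
    isRepulsiveFiniteRange_scalePotential hv hs
  have hv₁M : ∃ M : ℝ≥0, ∀ r, scalePotential (scatteringLength w).toReal⁻¹ v r ≤ M :=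
    scalePotential_bounded hvM _
  have hv₁a : scatteringLength (scalePotential (scatteringLength w).toReal⁻¹ v) = 1 := by
    simpa only [hvw] using scatteringLength_scalePotential_eq_one hv0 hvtop
  have hv₁BEC : ∃ ρ₀ : ℝ, 0 < ρ₀ ∧ ∀ ρ : ℝ, 0 < ρ → ρ < ρ₀ →
      HasGroundStateBEC (scalePotential (scatteringLength w).toReal⁻¹ v) ρ :=
    (diluteBEC_scalePotential_iff v hs).2 hBECv
  -- BT from `v₁`: every bounded admissible unit-`𝔞` gas condenses at small density
  have hsoft : ∀ u : ℝ → ℝ≥0∞, IsRepulsiveFiniteRange u → (∃ M : ℝ≥0, ∀ r, u r ≤ M) →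
      scatteringLength u = 1 →
      ∃ ρ₀ : ℝ, 0 < ρ₀ ∧ ∀ ρ : ℝ, 0 < ρ → ρ < ρ₀ → HasGroundStateBEC u ρ :=
    fun u hu huM hua => hBT _ u hv₁ hu hv₁M huM hv₁a hua hv₁BEC
  -- SC at `𝔞 = 1` for the rescaled target `w₁`, then undo the dilation
  have hw₁ : IsRepulsiveFiniteRange (scalePotential (scatteringLength w).toReal⁻¹ w) :=
    isRepulsiveFiniteRange_scalePotential hw hs
  exact (diluteBEC_scalePotential_iff w hs).1
    (hSC hsoft _ hw₁ (scatteringLength_scalePotential_eq_one h0 hwtop))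

/-- **Registration form** at the item's primary-route copy of the shared crux
(`BECChargeConjugationRP.ScatteringLengthTransfer`, definitionally the statement concluded by `_of`).
It USES the two sorried stubs: a certificate that they compose to the crux, not a proof of it. -/
theorem ScatteringLengthTransfer_proof :
    Summit.AtomisticToContinuum.BoseEinsteinCondensation.Theses.BECChargeConjugationRP.ScatteringLengthTransfer :=
  ScatteringLengthTransfer_of stub_boundedTransfer stub_softClosure

/-! ## SC is implied by the standing crux `HardCoreExtension` (stmt-11786) — proved -/

/-- A smooth-class potential (finite, `C²` radial profile on `ℝ³`, finite range) is bounded on the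
physical radii `[0, ∞)`: after cutting the (never evaluated) negative radii it is bounded outright.
[folklore] -/
theorem bounded_indicator_of_smoothClass {v : ℝ → ℝ≥0∞} (hv : IsRepulsiveFiniteRange v)
    (htop : ∀ r, v r ≠ ⊤) (hC : ContDiff ℝ 2 (fun x : Space => (v ‖x‖).toReal)) :
    ∃ M : ℝ≥0, ∀ r, (Set.Ici (0 : ℝ)).indicator v r ≤ M := by
  obtain ⟨-, R₀, hR₀⟩ := hv
  obtain ⟨B, hB⟩ := (isCompact_closedBall (0 : Space) (max R₀ 0)).exists_bound_of_continuousOn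
    hC.continuous.continuousOn
  refine ⟨B.toNNReal, fun r => ?_⟩
  by_cases hr : 0 ≤ r
  · rw [Set.indicator_of_mem (Set.mem_Ici.2 hr)]
    by_cases hrR : R₀ < r
    · simp [hR₀ r hrR]
    · replace hrR : r ≤ R₀ := le_of_not_gt hrR
      let e : Space := EuclideanSpace.single (0 : Fin 3) (1 : ℝ)
      have he : ‖e‖ = 1 := by simp [e]
      have hx : ‖r • e‖ = r := by rw [norm_smul, he, mul_one, Real.norm_of_nonneg hr]
      have hmem : r • e ∈ Metric.closedBall (0 : Space) (max R₀ 0) := by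
        rw [Metric.mem_closedBall, dist_zero_right, hx]
        exact hrR.trans (le_max_left _ _)
      have h1 := hB _ hmem
      rw [hx, Real.norm_of_nonneg ENNReal.toReal_nonneg] at h1
      calc v r = ENNReal.ofReal (v r).toReal := (ENNReal.ofReal_toReal (htop r)).symm
        _ ≤ ENNReal.ofReal B := ENNReal.ofReal_le_ofReal h1
        _ = (B.toNNReal : ℝ≥0∞) := rfl
  · rw [Set.indicator_of_notMem (by simpa using hr)]
    exact zero_le

/-- **`HardCoreExtension → SC`.** Given SC's hypothesis (all bounded admissible unit-`𝔞` gases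
condense), un-gauging gives dilute BEC of every bounded admissible gas, in particular (after cutting
negative radii, which changes neither admissibility, nor the energy form, nor `𝔞`) of every
smooth-class potential; `HardCoreExtension` then yields the whole conjunct, a fortiori SC's
conclusion. So a proof of stmt-AtomisticToContinuum-11786 closes `stub_softClosure` by `exact`. -/
theorem softClosure_of_hardCoreExtension
    (hHCE : Summit.AtomisticToContinuum.BoseEinsteinCondensation.Theses.BECConjugateDomination.HardCoreExtension) :
    (∀ u : ℝ → ℝ≥0∞, IsRepulsiveFiniteRange u → (∃ M : ℝ≥0, ∀ r, u r ≤ M) →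
        scatteringLength u = 1 →
        ∃ ρ₀ : ℝ, 0 < ρ₀ ∧ ∀ ρ : ℝ, 0 < ρ → ρ < ρ₀ → HasGroundStateBEC u ρ) →
    ∀ w : ℝ → ℝ≥0∞, IsRepulsiveFiniteRange w → scatteringLength w = 1 →
      ∃ ρ₀ : ℝ, 0 < ρ₀ ∧ ∀ ρ : ℝ, 0 < ρ → ρ < ρ₀ → HasGroundStateBEC w ρ := by
  intro hsoft w hw _
  suffices hall : Literature.MathematicalPhysics.QuantumManyBody.BoseGas.BoseEinsteinCondensation from
    hall w hw
  refine hHCE fun v hv htop hC _ => ?_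
  -- cut the negative radii: `v' = 1_{[0,∞)} v` is bounded, admissible, and physically identical
  have hagree : ∀ r, 0 ≤ r → (Set.Ici (0 : ℝ)).indicator v r = v r := fun r hr =>
    Set.indicator_of_mem (Set.mem_Ici.2 hr) _
  have hv' : IsRepulsiveFiniteRange ((Set.Ici (0 : ℝ)).indicator v) := by
    refine ⟨hv.1.indicator measurableSet_Ici, ?_⟩
    obtain ⟨R₀, hR₀⟩ := hv.2
    refine ⟨max R₀ 0, fun r hr => ?_⟩
    rw [hagree r ((le_max_right _ _).trans hr.le)]
    exact hR₀ r ((le_max_left _ _).trans_lt hr)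
  obtain ⟨ρ₀, hρ₀, hBEC⟩ :=
    diluteBEC_bounded_of_unitGauge hsoft _ hv' (bounded_indicator_of_smoothClass hv htop hC)
  exact ⟨ρ₀, hρ₀, fun ρ hρ hlt => (hasGroundStateBEC_congr_nonneg hagree ρ).1 (hBEC ρ hρ hlt)⟩

end Summit.AtomisticToContinuum.BoseEinsteinCondensation.Cruxes.ScatteringLengthTransfer.Gauge

end
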